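import Summits.Ventures.HSemireg.UntwistCocycleTwist
import Literature.AlgebraicGeometry.Motives.ChernClassesProofs
import HarnessLib

/-!
# Venture HSemireg — the cocycle twist `F ⊗ M` is locally isomorphic to `F`; twists of finite locally free
# modules are finite locally free (th-4 file #14; sequel of `UntwistCocycleTwist.lean`)

HONEST FRAMING. Section calculus on the real carriers of `UntwistCocycleTwist.lean`. Nothing is asserted about any
variety; no gerbe; nothing here says HC, HC_CM or HC_AV is proved.

For a Čech cocycle of units `c = (U_x, g_{xy})` on a scheme `X` and an `𝒪_X`-module `E`, over every open `W ⊆ U_z`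
inside ONE member of the cover the twist is trivial: **`twistTrivOver c E z W hW : E|_W ≅ (E⟨c⟩)|_W`**,
`e ↦ (g_{x z} · e|_{W ∩ U_x})_x` (the section `e ⊗ t_z`, `t_z` the local generator of `M = lineBundle c` over `U_z`,
cf. `Modules/LineBundleOfCocycle.lineBundleTriv` for `E = 𝒪_X`), with inverse `s ↦ s_z` (the `z`-coordinate).
Consequently **`isFiniteLocallyFree_twist`**: if `E` is finite locally free then so is `E⟨c⟩ = E ⊗ M` (trivialise `E`
on `U ∋ x`, shrink to `U ∩ U_x`, compose with `twistTrivOver`) — this DISCHARGES the binder «`E ⊗ M_B` finite locally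
free» (`hE'`) of `UntwistCocycleTwistSigma.isISemiregular_iff_twist`, so that on the sheaf carriers of the untwisted
reading of route R1.0 the ONLY remaining binder is the Leibniz rule (`hσ`).

## Contents (everything proved; 0 named facts; 0 sorry)

* `trivFamily`, `trivSection c E z hV e ∈ Γ(E⟨c⟩, V)` (`V ⊆ U_z`) with its calculus (`comp_trivSection`, `_zero`,
  `_add`, `_smul`, `_map`, `comp_trivSection_self`, `trivSection_comp_self`);
* `toTwistOver`, `ofTwistOver`, **`twistTrivOver c E z W hW : E.over W ≅ (twist c E).over W`**;
* **`isFiniteLocallyFree_twist`**.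

## References

* R. Hartshorne, *Algebraic Geometry*, GTM 52 (1977), II Ex. 1.22, II.5 (locally free sheaves). [Hartshorne1977]
* The Stacks Project, Tag 01C6 (finite locally free modules), Tag 01CR. [StacksProject]
-/

noncomputable section

open CategoryTheory AlgebraicGeometry TopologicalSpace Opposite

namespace Summit.Ventures.HSemireg

open Literature.AlgebraicGeometry.Modules Literature.AlgebraicGeometry.Motives

universe u

variable {X : Scheme.{u}} (c : UnitCocycle X) (E : X.Modules)

namespace CocycleTwist

/-! ### The local section `e ⊗ t_z` -/

/-- Restriction in `E⟨c⟩` along an arbitrary morphism of opens, componentwise. [folklore] -/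
theorem comp_map_hom {V V' : X.Opens} (i : V' ⟶ V) (s : Γ(twist c E, V)) (x : X) :
    comp c E ((twist c E).presheaf.map i.op s) x =
      E.presheaf.map (homOfLE (inf_le_inf_right (c.U x) i.le)).op (comp c E s x) := rfl

/-- The family `x ↦ g_{xz} · e|_{V ∩ U_x}` of a section `e ∈ Γ(E, V)`, `V ⊆ U_z`. [folklore] -/
def trivFamily (z : X) {V : X.Opens} (hV : V ≤ c.U z) (e : Γ(E, V)) : PointFamily c E V :=
  fun x => c.g x z (V ⊓ c.U x) inf_le_right (inf_le_left.trans hV) •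
    E.presheaf.map (homOfLE (inf_le_left : V ⊓ c.U x ≤ V)).op e

/-- Values of `trivFamily`. [folklore] -/
theorem trivFamily_apply (z : X) {V : X.Opens} (hV : V ≤ c.U z) (e : Γ(E, V)) (x : X) :
    trivFamily c E z hV e x = c.g x z (V ⊓ c.U x) inf_le_right (inf_le_left.trans hV) •
      E.presheaf.map (homOfLE (inf_le_left : V ⊓ c.U x ≤ V)).op e := rfl

/-- `trivFamily` satisfies the twisting relation (`g_{xy} g_{yz} = g_{xz}`). [folklore] -/
theorem trivFamily_mem (z : X) {V : X.Opens} (hV : V ≤ c.U z) (e : Γ(E, V)) :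
    trivFamily c E z hV e ∈ twistFamilies c E V := by
  intro x y W hW hx hy
  rw [trivFamily_apply, trivFamily_apply, Scheme.Modules.map_smul, Scheme.Modules.map_smul, map_g_apply,
    map_g_apply, presheaf_map_map, presheaf_map_map, smul_smul, c.g_mul]
  rfl

/-- **The section `e ⊗ t_z ∈ Γ(E⟨c⟩, V)`** of the twist determined by `e ∈ Γ(E, V)`, `V ⊆ U_z`. [folklore] -/
def trivSection (z : X) {V : X.Opens} (hV : V ≤ c.U z) (e : Γ(E, V)) : Γ(twist c E, V) :=
  mkFamily c E (trivFamily c E z hV e) (trivFamily_mem c E z hV e)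

/-- Coordinates of `e ⊗ t_z`: `g_{xz} · e|`. [folklore] -/
@[simp]
theorem comp_trivSection (z : X) {V : X.Opens} (hV : V ≤ c.U z) (e : Γ(E, V)) (x : X) :
    comp c E (trivSection c E z hV e) x = c.g x z (V ⊓ c.U x) inf_le_right (inf_le_left.trans hV) •
      E.presheaf.map (homOfLE (inf_le_left : V ⊓ c.U x ≤ V)).op e := rfl

/-- `0 ⊗ t_z = 0`. [folklore] -/
theorem trivSection_zero (z : X) {V : X.Opens} (hV : V ≤ c.U z) : trivSection c E z hV 0 = 0 :=
  twist_ext c E fun x => by rw [comp_trivSection, comp_zero, map_zero, smul_zero]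

/-- `e ⊗ t_z` is additive in `e`. [folklore] -/
theorem trivSection_add (z : X) {V : X.Opens} (hV : V ≤ c.U z) (e e' : Γ(E, V)) :
    trivSection c E z hV (e + e') = trivSection c E z hV e + trivSection c E z hV e' :=
  twist_ext c E fun x => by rw [comp_trivSection, comp_add, comp_trivSection, comp_trivSection, map_add, smul_add]

/-- `e ⊗ t_z` is `𝒪_X(V)`-linear in `e`. [folklore] -/
theorem trivSection_smul (z : X) {V : X.Opens} (hV : V ≤ c.U z) (r : Γ(X, V)) (e : Γ(E, V)) :
    trivSection c E z hV (r • e) = r • trivSection c E z hV e :=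
  twist_ext c E fun x => by
    rw [comp_trivSection, comp_smul, comp_trivSection, Scheme.Modules.map_smul, smul_smul, smul_smul, mul_comm]

/-- `e ⊗ t_z` commutes with restriction. [folklore] -/
theorem trivSection_map (z : X) {V V' : X.Opens} (hV : V ≤ c.U z) (i : V' ⟶ V) (e : Γ(E, V)) :
    (twist c E).presheaf.map i.op (trivSection c E z hV e) =
      trivSection c E z (i.le.trans hV) (E.presheaf.map i.op e) :=
  twist_ext c E fun x => by
    rw [comp_map_hom, comp_trivSection, comp_trivSection, Scheme.Modules.map_smul, map_g_apply,
      presheaf_map_map, presheaf_map_map]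
    rfl

/-- **The `z`-coordinate of `e ⊗ t_z` is `e`** (`g_{zz} = 1`), up to the restriction `V ∩ U_z = V`. [folklore] -/
theorem comp_trivSection_self (z : X) {V : X.Opens} (hV : V ≤ c.U z) (e : Γ(E, V)) :
    comp c E (trivSection c E z hV e) z = E.presheaf.map (homOfLE (inf_le_left : V ⊓ c.U z ≤ V)).op e := by
  rw [comp_trivSection, c.g_self, one_smul]

/-- **`s = s_z ⊗ t_z`**: over `V ⊆ U_z` a section of the twist is determined by its `z`-coordinate (the relation
at `(x, z)`). [folklore] -/
theorem trivSection_comp_self (z : X) {V : X.Opens} (hV : V ≤ c.U z) (s : Γ(twist c E, V)) :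
    trivSection c E z hV (E.presheaf.map (homOfLE (le_inf le_rfl hV : V ≤ V ⊓ c.U z)).op (comp c E s z)) = s :=
  twist_ext c E fun x => by
    have hid : ∀ (h : V ⊓ c.U x ≤ V ⊓ c.U x) (k : Γ(E, V ⊓ c.U x)), E.presheaf.map (homOfLE h).op k = k :=
      fun h k => by
        rw [Subsingleton.elim (homOfLE h) (𝟙 _), op_id, (Scheme.Modules.presheaf E).map_id]
        rfl
    have key := comp_rel c E s x z (W := V ⊓ c.U x) inf_le_left inf_le_right (inf_le_left.trans hV)
    rw [hid] at key
    rw [comp_trivSection, presheaf_map_map, key]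
    rfl

/-! ### The local trivialisation `E|_W ≅ (E⟨c⟩)|_W` over `W ⊆ U_z` -/

/-- `E|_W ⟶ (E⟨c⟩)|_W`, `e ↦ e ⊗ t_z`, over `W ⊆ U_z`. [folklore] -/
def toTwistOver (z : X) (W : X.Opens) (hW : W ≤ c.U z) : E.over W ⟶ (twist c E).over W where
  val := PresheafOfModules.homMk
    { app := fun V => AddCommGrpCat.ofHom
        { toFun := fun e => (trivSection c E z (V.unop.hom.le.trans hW) e : Γ(twist c E, V.unop.left))
          map_zero' := trivSection_zero c E z _
          map_add' := fun e e' => trivSection_add c E z _ e e' }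
      naturality := fun {V V'} i => by
        ext e
        change trivSection c E z (V'.unop.hom.le.trans hW) (E.presheaf.map i.unop.left.op e) =
          (twist c E).presheaf.map i.unop.left.op (trivSection c E z (V.unop.hom.le.trans hW) e)
        exact (trivSection_map c E z _ i.unop.left e).symm }
    (fun V (r : Γ(X, V.unop.left)) (e : Γ(E, V.unop.left)) => by
      change trivSection c E z _ (r • e) = r • trivSection c E z _ e
      exact trivSection_smul c E z _ r e)

/-- Values of `toTwistOver`. [folklore] -/
@[simp]
theorem appLE_toTwistOver (z : X) (W : X.Opens) (hW : W ≤ c.U z) {V : X.Opens} (k : V ⟶ W) (e : Γ(E, V)) :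
    appLE (toTwistOver c E z W hW) k e = trivSection c E z (k.le.trans hW) e := rfl

/-- The inequality `V ≤ V ∩ U_z` for `V` over `W ⊆ U_z`. [folklore] -/
theorem le_inf_U_of_over (z : X) (W : X.Opens) (hW : W ≤ c.U z) (V : (Over W)ᵒᵖ) :
    V.unop.left ≤ V.unop.left ⊓ c.U z :=
  le_inf le_rfl (V.unop.hom.le.trans hW)

/-- `(E⟨c⟩)|_W ⟶ E|_W`, `s ↦ s_z` (the `z`-coordinate, restricted back along `V ∩ U_z = V`). [folklore] -/
def ofTwistOver (z : X) (W : X.Opens) (hW : W ≤ c.U z) : (twist c E).over W ⟶ E.over W where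
  val := PresheafOfModules.homMk
    { app := fun V => AddCommGrpCat.ofHom
        { toFun := fun s => (E.presheaf.map (homOfLE (le_inf_U_of_over c z W hW V)).op
            (comp c E (V := V.unop.left) s z) : Γ(E, V.unop.left))
          map_zero' := by
            change (E.presheaf.map (homOfLE (le_inf_U_of_over c z W hW V)).op (0 : Γ(E, V.unop.left ⊓ c.U z)) :
              Γ(E, V.unop.left)) = 0
            exact map_zero _
          map_add' := fun s s' => by
            change (E.presheaf.map (homOfLE (le_inf_U_of_over c z W hW V)).op
              (comp c E (V := V.unop.left) s z + comp c E (V := V.unop.left) s' z) : Γ(E, V.unop.left)) = _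
            exact map_add _ _ _ }
      naturality := fun {V V'} i => by
        ext s
        change (E.presheaf.map (homOfLE (le_inf_U_of_over c z W hW V')).op
            (comp c E (V := V'.unop.left) ((twist c E).presheaf.map i.unop.left.op s) z) : Γ(E, V'.unop.left)) =
          E.presheaf.map i.unop.left.op
            (E.presheaf.map (homOfLE (le_inf_U_of_over c z W hW V)).op (comp c E (V := V.unop.left) s z))
        rw [comp_map_hom, presheaf_map_map, presheaf_map_map]
        rfl }
    (fun V (r : Γ(X, V.unop.left)) (s : Γ(twist c E, V.unop.left)) => by
      change (E.presheaf.map (homOfLE (le_inf_U_of_over c z W hW V)).op (comp c E (V := V.unop.left) (r • s) z) :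
          Γ(E, V.unop.left)) =
        r • (E.presheaf.map (homOfLE (le_inf_U_of_over c z W hW V)).op (comp c E (V := V.unop.left) s z) :
          Γ(E, V.unop.left))
      rw [comp_smul, Scheme.Modules.map_smul, ← CategoryTheory.comp_apply, ← Functor.map_comp]
      have hid : ((homOfLE (inf_le_left : V.unop.left ⊓ c.U z ≤ V.unop.left)).op ≫
          (homOfLE (le_inf_U_of_over c z W hW V)).op) = 𝟙 _ :=
        Subsingleton.elim _ _
      rw [hid, X.presheaf.map_id]
      rfl)

/-- Values of `ofTwistOver`. [folklore] -/
@[simp]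
theorem appLE_ofTwistOver (z : X) (W : X.Opens) (hW : W ≤ c.U z) {V : X.Opens} (k : V ⟶ W)
    (s : Γ(twist c E, V)) :
    appLE (ofTwistOver c E z W hW) k s =
      E.presheaf.map (homOfLE (le_inf le_rfl (k.le.trans hW) : V ≤ V ⊓ c.U z)).op (comp c E s z) := rfl


/-- **The local trivialisation of the twist**: `E|_W ≅ (E ⊗ M)|_W` over an open `W ⊆ U_z` inside one member of
the cover of `c` (`e ↦ e ⊗ t_z`, inverse `s ↦ s_z`). [cite: Hartshorne1977, II Ex. 1.22] -/
def twistTrivOver (z : X) (W : X.Opens) (hW : W ≤ c.U z) : E.over W ≅ (twist c E).over W where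
  hom := toTwistOver c E z W hW
  inv := ofTwistOver c E z W hW
  hom_inv_id := by
    refine hom_ext_of_appLE fun V k e => ?_
    rw [appLE_comp, appLE_toTwistOver, appLE_ofTwistOver, appLE_id, comp_trivSection_self, presheaf_map_map]
    have hid : (homOfLE (le_inf le_rfl (k.le.trans hW) : V ≤ V ⊓ c.U z) ≫
        homOfLE (inf_le_left : V ⊓ c.U z ≤ V)) = 𝟙 _ := Subsingleton.elim _ _
    rw [hid, op_id, (Scheme.Modules.presheaf E).map_id]
    rfl
  inv_hom_id := by
    refine hom_ext_of_appLE fun V k s => ?_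
    rw [appLE_comp, appLE_ofTwistOver, appLE_toTwistOver, appLE_id, trivSection_comp_self]

/-! ### Finite local freeness is preserved -/

variable {E} in
/-- **`E ⊗ M` is finite locally free if `E` is**: at `x`, trivialise `E` over `U ∋ x`, shrink to `U ∩ U_x`
(Mathlib/tree `restrictTrivialisation`) and compose with `twistTrivOver` at `z = x`.
[cite: StacksProject, Tag 01C6 (Modules Def. 17.14.1 (2)); Hartshorne1977, II.5] -/
theorem isFiniteLocallyFree_twist (hE : IsFiniteLocallyFree E) : IsFiniteLocallyFree (twist c E) := by
  intro x
  obtain ⟨U, hxU, I, hI, ⟨e⟩⟩ := hE x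
  exact ⟨U ⊓ c.U x, ⟨hxU, c.mem x⟩, I, hI,
    ⟨SheafOfModules.restrictTrivialisation (R := X.ringCatSheaf) (homOfLE (inf_le_left : U ⊓ c.U x ≤ U)) e ≪≫
      twistTrivOver c E x (U ⊓ c.U x) inf_le_right⟩⟩

end CocycleTwist

end Summit.Ventures.HSemireg

end
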